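import Summits.AtomisticToContinuum.Crystallization.Theses.PhononSlackCertificates
import Summits.AtomisticToContinuum.Crystallization.Theorems.ChargedEnergyGap.Negative.Unconditional

/-!
# `CoerciveTwoShellGap` (stmt-AtomisticToContinuum-13956), negative side I: the tolerance is load-bearing

Crux (route `PhononSlackCertificates`, target): `∀ δ > 0, ∃ g > 0`, every `δ`-separated
`x : Fin N → ℝ³` has `N·e* + g·#{i : ¬ IsTwoShellGood (1/20) (47/50) 1 x i} ≤ 𝓔_LJ(x)`.

This file (refuter, cdisprove seat, cycle 1) proves that the positive tolerance is load-bearing: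
with `ε ≤ 0` in place of `1/20` the statement is FALSE (`not_tol_of_nonpos`).
Mechanism: Lennard-Jones ground states exist and are `δ₀`-separated (tree facts
`LennardJonesGroundStatesExist_holds`, `LennardJonesMinimalDistance_holds`), `E(N)/N → e*`
(`ChargedEnergyGapNegative.crysEnergyLimit`), and the explicit generic perturbation
`xᵢ + t·4ⁱ·e₀` of the sibling negative side (`ChargedEnergyGapNegative.pert`), taken with
`t < δ₀/(2·4ᴺ)`, keeps `δ₀/2`-separation, costs arbitrarily little energy and makes the distances
from each site pairwise distinct — whence every particle is exactly-bad, because an exact two-shell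
match needs two equidistant neighbours (two of the `18` pattern points share a norm).
The tolerances at which the crux holds form an up-set (`tol_mono`) missing
`(−∞, 0]`; the crux asserts `1/20` belongs to it.  All `[folklore]`.
-/

noncomputable section

namespace Summit.AtomisticToContinuum.Crystallization.Theorems.CoerciveTwoShellGapNegative

open scoped BigOperators Classical
open Literature.MathematicalPhysics.StatisticalMechanics Literature.Geometry.DiscreteGeometry
open Summit.AtomisticToContinuum.Crystallization.Theorems.ChargedEnergyGapNegative
open Summit.AtomisticToContinuum.Crystallization.Theses.PhononSlackCertificates

/-! ## §1 Counting bad particles -/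

/-- `#bad ≤ N`. [folklore] -/
theorem bad_le (ε : ℝ) {N : ℕ} (x : Fin N → E3) :
    Nat.card {i : Fin N // ¬ IsTwoShellGood ε (47 / 50) 1 x i} ≤ N := by
  exact (Finite.card_subtype_le _).trans_eq (Nat.card_fin N)

/-- If nobody is good, `#bad = N`. [folklore] -/
theorem bad_eq_of_forall (ε : ℝ) {N : ℕ} {x : Fin N → E3}
    (h : ∀ i : Fin N, ¬ IsTwoShellGood ε (47 / 50) 1 x i) :
    Nat.card {i : Fin N // ¬ IsTwoShellGood ε (47 / 50) 1 x i} = N := by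
  rw [Nat.card_congr (Equiv.subtypeUnivEquiv h), Nat.card_eq_fintype_card, Fintype.card_fin]

/-- Badness is antitone in the tolerance: `#bad ε' ≤ #bad ε` for `ε ≤ ε'`. [folklore] -/
theorem bad_anti {ε ε' : ℝ} (hε : ε ≤ ε') {N : ℕ} (x : Fin N → E3) :
    Nat.card {i : Fin N // ¬ IsTwoShellGood ε' (47 / 50) 1 x i} ≤
      Nat.card {i : Fin N // ¬ IsTwoShellGood ε (47 / 50) 1 x i} := by
  exact Nat.card_mono (Set.toFinite _) fun i hi hg => hi (hg.mono hε (by norm_num))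

/-- **With at most `18` particles nobody is good** (a goodness witness assigns the `18` pattern
points injectively to particles other than the centre). [folklore] -/
theorem not_isTwoShellGood_of_le {ε aLo aHi : ℝ} {N : ℕ} (hN : N ≤ 18) (x : Fin N → E3)
    (i : Fin N) : ¬ IsTwoShellGood ε aLo aHi x i := by
  rintro ⟨a, -, -, A, P, f, hP, hf, hinj, -⟩
  have hcard : P.card = 18 := card_eq_eighteen_of_twoShellPattern hP
  have himg : P.image f ⊆ Finset.univ.erase i := by
    intro j hj
    obtain ⟨v, hv, rfl⟩ := Finset.mem_image.1 hj
    exact Finset.mem_erase.2 ⟨(hf v hv).1, Finset.mem_univ _⟩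
  have h1 : (P.image f).card = 18 := by rw [Finset.card_image_of_injOn hinj, hcard]
  have h2 : (Finset.univ.erase i).card = N - 1 := by
    rw [Finset.card_erase_of_mem (Finset.mem_univ i), Finset.card_univ, Fintype.card_fin]
  have := Finset.card_le_card himg
  omega

/-- Hence small configurations are all-bad. [folklore] -/
theorem bad_eq_of_le (ε : ℝ) {N : ℕ} (hN : N ≤ 18) (x : Fin N → E3) :
    Nat.card {i : Fin N // ¬ IsTwoShellGood ε (47 / 50) 1 x i} = N :=
  bad_eq_of_forall ε fun i => not_isTwoShellGood_of_le hN x i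

/-! ## §2 The tolerance cannot go to `0` -/

/-! `Tol ε` below abbreviates, in prose only, the crux with tolerance `ε` in place of `1/20`:
`∀ δ > 0, ∃ g > 0, ∀ N x, x δ-separated → N·(⨅_Q e(Q)) + g·#{i : ¬ IsTwoShellGood ε (47/50) 1 x i} ≤ 𝓔(x)`;
the crux is `Tol (1/20)` verbatim (`coerciveTwoShellGap_iff_tol_twentieth`). No definition is
introduced: the statements are spelled out. -/

/-- The crux is the `ε = 1/20` instance of the tolerance family (definitionally). [folklore] -/
theorem coerciveTwoShellGap_iff_tol_twentieth :
    CoerciveTwoShellGap ↔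
      ∀ δ : ℝ, 0 < δ → ∃ g : ℝ, 0 < g ∧ ∀ (N : ℕ) (x : Fin N → E3),
        (∀ i j : Fin N, i ≠ j → δ ≤ dist (x i) (x j)) →
          (N : ℝ) * (⨅ Q : PeriodicConfiguration 3, Q.energyPerParticle lennardJones) +
              g * (Nat.card {i : Fin N // ¬ IsTwoShellGood (1 / 20) (47 / 50) 1 x i} : ℝ) ≤
            interactionEnergy lennardJones x :=
  Iff.rfl

/-- **Monotonicity**: the tolerances at which the crux's shape holds form an up-set. [folklore] -/
theorem tol_mono {ε ε' : ℝ} (hε : ε ≤ ε')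
    (h : ∀ δ : ℝ, 0 < δ → ∃ g : ℝ, 0 < g ∧ ∀ (N : ℕ) (x : Fin N → E3),
      (∀ i j : Fin N, i ≠ j → δ ≤ dist (x i) (x j)) →
        (N : ℝ) * (⨅ Q : PeriodicConfiguration 3, Q.energyPerParticle lennardJones) +
            g * (Nat.card {i : Fin N // ¬ IsTwoShellGood ε (47 / 50) 1 x i} : ℝ) ≤
          interactionEnergy lennardJones x) :
    ∀ δ : ℝ, 0 < δ → ∃ g : ℝ, 0 < g ∧ ∀ (N : ℕ) (x : Fin N → E3),
      (∀ i j : Fin N, i ≠ j → δ ≤ dist (x i) (x j)) →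
        (N : ℝ) * (⨅ Q : PeriodicConfiguration 3, Q.energyPerParticle lennardJones) +
            g * (Nat.card {i : Fin N // ¬ IsTwoShellGood ε' (47 / 50) 1 x i} : ℝ) ≤
          interactionEnergy lennardJones x := by
  intro δ hδ
  obtain ⟨g, hg, hG⟩ := h δ hδ
  refine ⟨g, hg, fun N x hx => le_trans ?_ (hG N x hx)⟩
  have : (Nat.card {i : Fin N // ¬ IsTwoShellGood ε' (47 / 50) 1 x i} : ℝ) ≤
      Nat.card {i : Fin N // ¬ IsTwoShellGood ε (47 / 50) 1 x i} := by exact_mod_cast bad_anti hε x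
  nlinarith

/-- **Exact goodness needs two equidistant neighbours**: at tolerance `ε ≤ 0` the match is exact,
`x (f v) = x i + a•A v`, so `dist (x i) (x (f v)) = a‖v‖`, and two of the `18` pattern points share
a norm (only the values `1`, `√2` occur); hence a particle whose distances to the other particles are
pairwise distinct is `ε`-bad. [folklore] -/
theorem not_isTwoShellGood_of_nonpos_of_distinct {ε aLo aHi : ℝ} (hε : ε ≤ 0) (haLo : 0 ≤ aLo)
    {N : ℕ} {x : Fin N → E3} {i : Fin N}
    (h : ∀ j k : Fin N, j ≠ i → k ≠ i → j ≠ k → dist (x i) (x j) ≠ dist (x i) (x k)) :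
    ¬ IsTwoShellGood ε aLo aHi x i := by
  rintro ⟨a, ha₁, -, A, P, f, hP, hf, hinj, -⟩
  have ha0 : 0 ≤ a := haLo.trans ha₁
  have hcard : P.card = 18 := card_eq_eighteen_of_twoShellPattern hP
  have hmaps : ∀ v ∈ P, ‖v‖ ∈ ({1, Real.sqrt 2} : Finset ℝ) := by
    intro v hv
    rcases hP with rfl | rfl
    · rcases norm_of_mem_fccTwoShellPattern hv with h | h <;> simp [h]
    · rcases norm_of_mem_hcpTwoShellPattern hv with h | h <;> simp [h]
  have hlt : ({1, Real.sqrt 2} : Finset ℝ).card < P.card := by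
    rw [hcard]; exact Finset.card_le_two.trans_lt (by norm_num)
  obtain ⟨v, hv, w, hw, hvw, heq⟩ := Finset.exists_ne_map_eq_of_card_lt_of_maps_to hlt hmaps
  have hexact : ∀ u ∈ P, dist (x i) (x (f u)) = a * ‖u‖ := by
    intro u hu
    have h1 : dist (x (f u)) (x i + a • A u) ≤ ε * a := (hf u hu).2
    have h2 : ε * a ≤ 0 := by nlinarith
    have h3 : x (f u) = x i + a • A u := dist_le_zero.1 (h1.trans h2)
    rw [h3, dist_eq_norm, sub_add_cancel_left, norm_neg, norm_smul, Real.norm_of_nonneg ha0,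
      A.norm_map]
  have hfv : f v ≠ f w := fun hh => hvw (hinj hv hw hh)
  exact h (f v) (f w) (hf v hv).1 (hf w hw).1 hfv (by rw [hexact v hv, hexact w hw, heq])

section Perturbation

variable {N : ℕ}

/-- Separation survives the tree's generic perturbation `yᵢ + t·4ⁱ·e₀`:
`dist − |t|·4ᴺ ≤ dist after`. [folklore] -/
theorem dist_pert_ge (y : Fin N → E3) (t : ℝ) (i j : Fin N) :
    dist (y i) (y j) - |t| * (4 : ℝ) ^ N ≤ dist (pert y t i) (pert y t j) := by
  have hw : ∀ k : Fin N, 0 ≤ wt k ∧ wt k ≤ (4 : ℝ) ^ N := fun k =>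
    ⟨by unfold wt; positivity, by
      unfold wt; exact pow_le_pow_right₀ (by norm_num) k.2.le⟩
  have hdiff : |wt i - wt j| ≤ (4 : ℝ) ^ N := by
    rw [abs_sub_le_iff]; constructor <;> linarith [hw i, hw j]
  rw [dist_eq_norm, dist_eq_norm, pert_sub]
  have h1 : ‖y i - y j‖ - ‖(t * (wt i - wt j)) • e0‖ ≤
      ‖(y i - y j) + (t * (wt i - wt j)) • e0‖ := by
    have := norm_sub_norm_le (y i - y j) (-((t * (wt i - wt j)) • e0))
    rw [norm_neg, sub_neg_eq_add] at this
    exact this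
  have h2 : ‖(t * (wt i - wt j)) • e0‖ ≤ |t| * (4 : ℝ) ^ N := by
    rw [norm_smul, norm_e0, mul_one, Real.norm_eq_abs, abs_mul]
    exact mul_le_mul_of_nonneg_left hdiff (abs_nonneg t)
  linarith

/-- The tree's `exists_pert` with the parameter additionally below a prescribed `τ > 0`: an
injective perturbation with pairwise distinct distances from each site, energy cost `< ε`,
`0 < t < τ`. [folklore] -/
theorem exists_pert_small (y : Fin N → E3) (hy : Function.Injective y) {ε τ : ℝ} (hε : 0 < ε)
    (hτ : 0 < τ) :
    ∃ t : ℝ, 0 < t ∧ t < τ ∧ Function.Injective (pert y t) ∧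
      (∀ i j k : Fin N, j ≠ i → k ≠ i → j ≠ k →
        dist (pert y t i) (pert y t j) ≠ dist (pert y t i) (pert y t k)) ∧
      interactionEnergy lennardJones (pert y t) < interactionEnergy lennardJones y + ε := by
  have hev : ∀ᶠ t in nhds (0 : ℝ),
      interactionEnergy lennardJones (pert y t) < interactionEnergy lennardJones y + ε :=
    (tendsto_energy_pert y hy).eventually (gt_mem_nhds (lt_add_of_pos_right _ hε))
  obtain ⟨r, hr, hball⟩ := Metric.eventually_nhds_iff.1 hev
  set B : Set ℝ :=
    (⋃ i : Fin N, ⋃ j : Fin N, ⋃ k : Fin N, {t : ℝ | j ≠ i ∧ k ≠ i ∧ j ≠ k ∧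
      dist (pert y t i) (pert y t j) = dist (pert y t i) (pert y t k)}) ∪
    ⋃ i : Fin N, ⋃ j : Fin N, {t : ℝ | i ≠ j ∧ pert y t i = pert y t j} with hB_def
  have hB : B.Finite :=
    (Set.finite_iUnion fun i => Set.finite_iUnion fun j => Set.finite_iUnion fun k =>
      finite_bad_triple y i j k).union
      (Set.finite_iUnion fun i => Set.finite_iUnion fun j => finite_bad_pair y i j)
  obtain ⟨t, ht, htB⟩ := ((Set.Ioo_infinite (lt_min hr hτ)).sdiff hB).nonempty
  have htr : t < r := ht.2.trans_le (min_le_left _ _)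
  refine ⟨t, ht.1, ht.2.trans_le (min_le_right _ _), ?_, ?_, hball ?_⟩
  · intro i j hij
    by_contra hne
    exact htB (Or.inr (Set.mem_iUnion.2 ⟨i, Set.mem_iUnion.2 ⟨j, hne, hij⟩⟩))
  · intro i j k hj hk hjk heq
    exact htB (Or.inl (Set.mem_iUnion.2 ⟨i, Set.mem_iUnion.2 ⟨j, Set.mem_iUnion.2
      ⟨k, hj, hk, hjk, heq⟩⟩⟩))
  · rw [Real.dist_eq, sub_zero, abs_of_pos ht.1]
    exact htr

end Perturbation

/-- **The tolerance is load-bearing**: with `ε ≤ 0` in place of `1/20` the crux is FALSE.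
Ground states are `δ₀`-separated and `E(N)/N → e*`; perturb a large one generically with
`t < δ₀/(2·4ᴺ)`: it stays `δ₀/2`-separated, its energy rises by `< N·g/2`, and every particle is
exactly-bad, so `N(e* + g) ≤ 𝓔 < N(e* + g)`.  (The crux asks the inequality at `δ = δ₀/2`; the
refutation therefore bites whatever `g(δ₀/2)` is offered.) [folklore] -/
theorem not_tol_of_nonpos {ε : ℝ} (hε : ε ≤ 0) :
    ¬ ∀ δ : ℝ, 0 < δ → ∃ g : ℝ, 0 < g ∧ ∀ (N : ℕ) (x : Fin N → E3),
      (∀ i j : Fin N, i ≠ j → δ ≤ dist (x i) (x j)) →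
        (N : ℝ) * (⨅ Q : PeriodicConfiguration 3, Q.energyPerParticle lennardJones) +
            g * (Nat.card {i : Fin N // ¬ IsTwoShellGood ε (47 / 50) 1 x i} : ℝ) ≤
          interactionEnergy lennardJones x := by
  intro hT
  obtain ⟨δ₀, hδ₀, hGS⟩ := exists_isGroundState_separated LennardJonesGroundStatesExist_holds
    LennardJonesMinimalDistance_holds
  obtain ⟨g, hg, hG⟩ := hT (δ₀ / 2) (half_pos hδ₀)
  -- a large ground state with energy per particle `< e* + g/2`
  have hlim : Filter.Tendsto (fun N : ℕ => groundStateEnergy lennardJones 3 N / N) Filter.atTop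
      (nhds eStar) := crysEnergyLimit
  have hev : ∀ᶠ N : ℕ in Filter.atTop, groundStateEnergy lennardJones 3 N / N < eStar + g / 2 :=
    hlim.eventually (gt_mem_nhds (by linarith))
  obtain ⟨N, hNlt, hN1⟩ := (hev.and (Filter.eventually_ge_atTop 1)).exists
  have hNr : (0 : ℝ) < N := by exact_mod_cast hN1
  obtain ⟨y, ⟨hyinj, hyE⟩, hysep⟩ := hGS N
  have hEy : interactionEnergy lennardJones y < (N : ℝ) * (eStar + g / 2) := by
    rw [hyE]
    rw [div_lt_iff₀ hNr] at hNlt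
    linarith
  -- perturb generically, keeping `δ₀/2`-separation
  obtain ⟨t, ht0, htτ, -, hdist, hE⟩ := exists_pert_small y hyinj (ε := (N : ℝ) * (g / 2))
    (τ := δ₀ / (2 * (4 : ℝ) ^ N)) (by positivity) (by positivity)
  have hsep : ∀ i j : Fin N, i ≠ j → δ₀ / 2 ≤ dist (pert y t i) (pert y t j) := by
    intro i j hij
    have h1 := dist_pert_ge y t i j
    have h2 := hysep i j hij
    have h3 : |t| * (4 : ℝ) ^ N ≤ δ₀ / 2 := by
      rw [abs_of_pos ht0]
      have := (lt_div_iff₀ (by positivity : (0 : ℝ) < 2 * (4 : ℝ) ^ N)).1 htτ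
      linarith
    linarith
  -- every particle is `ε`-bad
  have hbad : Nat.card {i : Fin N // ¬ IsTwoShellGood ε (47 / 50) 1 (pert y t) i} = N :=
    bad_eq_of_forall ε fun i => not_isTwoShellGood_of_nonpos_of_distinct hε (by norm_num) (hdist i)
  have := hG N (pert y t) hsep
  rw [hbad] at this
  change (N : ℝ) * eStar + g * (N : ℝ) ≤ _ at this
  nlinarith

/-- In particular the exact-pattern version (`ε = 0`) of the crux is false, while the crux claims
the `ε = 1/20` version: the threshold lies in `(0, 1/20]` if the crux is true. [folklore] -/
theorem not_tol_zero :
    ¬ ∀ δ : ℝ, 0 < δ → ∃ g : ℝ, 0 < g ∧ ∀ (N : ℕ) (x : Fin N → E3),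
      (∀ i j : Fin N, i ≠ j → δ ≤ dist (x i) (x j)) →
        (N : ℝ) * (⨅ Q : PeriodicConfiguration 3, Q.energyPerParticle lennardJones) +
            g * (Nat.card {i : Fin N // ¬ IsTwoShellGood 0 (47 / 50) 1 x i} : ℝ) ≤
          interactionEnergy lennardJones x :=
  not_tol_of_nonpos le_rfl

end Summit.AtomisticToContinuum.Crystallization.Theorems.CoerciveTwoShellGapNegative

end
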